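import Mathlib
import Summits.Ventures.HodgeRepro.PeriodCloserC7Stability

/-!
# PeriodCloserC7TwistPrimitive — the twisted characters of gen 1's (E3) discharge are PRIMITIVE on the local-ring model

Blind re-derivation cell `pub-hodge-repro`, seat night-2 (gen 3).  Target tree path
`lean/Summits/Ventures/HodgeRepro/PeriodCloserC7TwistPrimitive.lean`.  Continues gen 1's `PeriodCloserC7Stability.lean`
(`LocalChar.Primitive`, `LocalChar.Shallow`, `E3At_of_model`) and `GaussSumStability.lean` (`PsiAnn`, `unitOfSqZero`).

Gen 1 discharges (E3) at a place of `S₃` by twisting the four lines by ONE character `ρ` that is primitive of conductor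
`c` relative to the ideal `I = 𝔭^{⌈c/2⌉}/𝔭^c` (`ρ(1 + z) = ψ̃(a z)` on `I`, `a` a unit), the lines `χ′_j` being shallow
(trivial on the units `≡ 1` modulo the `ψ̃`-annihilator of `I`).  The product formula of `GaussSumProductLocal.lean` and
the sign statements of `OcticCMPointDeepSign.lean` ask for a character NON-TRIVIAL on `1 + A`, `A = PsiAnn ψ̃ 𝔪` the
`ψ̃`-annihilator of the maximal ideal (`= 𝔭^{c−1}/𝔭^c`).  This file proves that every twisted line `χ′_j ρ` is such:

`twist_nontrivial_on_ann` — if `ψ̃` is primitive, `I ≤ 𝔪`, `A` contains a non-zero `b ∈ I` with `b² = 0`, `ρ` is primitive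
relative to `(ψ̃, I, a)` and `χ` is shallow, then some `z₀ ∈ A` has `(χ ρ)(1 + z₀) ≠ 1` (take `z₀ = x b` with `ψ̃(x a b) ≠ 1`,
which primitivity of `ψ̃` supplies: `χ(1 + z₀) = 1` by shallowness, `ρ(1 + z₀) = ψ̃(a z₀) ≠ 1`).

Hence, at every place of `S₃` of the octic point, after gen 1's stability twist all four local signs are values of a
primitive character of the model — the input `hprim` of `eps_eq_one_or_neg_one_local` / `eps_kappaHalf_eq_one_or_neg_one`
— so the (E2)/(E3) checks there see signs `±1` on the kernel (with the conjugation data of `OcticCMPointConjDual.lean`).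
Nothing here says anything about the status of the Hodge conjecture for CM abelian varieties, which is NOT proved.
-/

set_option autoImplicit false

noncomputable section

namespace Summit.Ventures.HodgeRepro.PeriodCloser

open GaussSumStability

namespace LocalChar

variable {R : Type} [CommRing R] [Fintype R]

/-- A primitive additive character is non-trivial on every non-zero principal ideal: for `b ≠ 0` some `x` has
`ψ (x * b) ≠ 1` (Mathlib's `AddChar.IsPrimitive`: `mulShift ψ b ≠ 1`). -/
theorem exists_psi_mul_ne_one (ψ : AddChar R ℂ) (hψ : ψ.IsPrimitive) {b : R} (hb : b ≠ 0) :
    ∃ x : R, ψ (x * b) ≠ 1 := by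
  have h := hψ hb
  by_contra hcon
  apply h
  ext x
  rw [AddChar.mulShift_apply, AddChar.one_apply, mul_comm]
  by_contra hx
  exact hcon ⟨x, hx⟩

/-- **The twisted character is primitive on `1 + A`**: with `ψ` primitive, `I ≤ 𝔪`, a non-zero `b ∈ I ∩ A` with `b² = 0`,
`ρ` primitive relative to `(ψ, I, a)` and `χ` shallow, some `z₀ ∈ A = PsiAnn ψ 𝔪` has `(χ * ρ).unit (1 + z₀) ≠ 1`. -/
theorem twist_nontrivial_on_ann (ψ : AddChar R ℂ) (hψ : ψ.IsPrimitive) (𝔪 I : Ideal R) (hI : I ≤ 𝔪)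
    (χ ρ : LocalChar R) (a : Rˣ) (hρ : Primitive ψ I ρ a) (hχ : Shallow ψ I χ) (b : R) (hbA : PsiAnn ψ 𝔪 b)
    (hb0 : b ≠ 0) (hbI : b ∈ I) (hb2 : b * b = 0) :
    ∃ z₀ : R, PsiAnn ψ 𝔪 z₀ ∧ (χ * ρ).unit (1 + z₀) ≠ 1 := by
  have hab : (a : R) * b ≠ 0 := by
    intro h
    apply hb0
    have := congrArg (fun y => ((a⁻¹ : Rˣ) : R) * y) h
    simp only [mul_zero] at this
    rwa [← mul_assoc, Units.inv_mul, one_mul] at this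
  obtain ⟨x, hx⟩ := exists_psi_mul_ne_one ψ hψ hab
  refine ⟨x * b, hbA.mul_left x, ?_⟩
  have hzI : x * b ∈ I := I.mul_mem_left x hbI
  have hz2 : (x * b) * (x * b) = 0 := by
    calc (x * b) * (x * b) = (x * x) * (b * b) := by ring
      _ = 0 := by rw [hb2, mul_zero]
  -- `χ(1 + z₀) = 1` by shallowness: `1 + z₀` is a unit with `(1 + z₀) − 1 = z₀` in the `ψ`-annihilator of `I`
  have hχ1 : χ.unit (1 + x * b) = 1 := by
    have h := hχ (unitOfSqZero (x * b) hz2) (by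
      rw [unitOfSqZero_val, add_sub_cancel_left]
      intro z hz
      exact (hbA.mul_left x) z (hI hz))
    rwa [unitOfSqZero_val] at h
  -- `ρ(1 + z₀) = ψ(a z₀) = ψ(x (a b)) ≠ 1`
  have hρ1 : ρ.unit (1 + x * b) = ψ (x * ((a : R) * b)) := by
    rw [hρ (x * b) hzI]
    congr 1
    ring
  rw [mul_unit, MulChar.coeToFun_mul, Pi.mul_apply, hχ1, one_mul, hρ1]
  exact hx

end LocalChar

end Summit.Ventures.HodgeRepro.PeriodCloser

end
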